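import Literature.Analysis.FluidPDE.PlateauWindowKernels
import Literature.Analysis.FluidPDE.SlicedLocalEnergy
import Literature.Analysis.FluidPDE.SerrinEnstrophyGronwall
import Literature.Analysis.Calculus.SmoothCutoff
import HarnessLib

/-!
# Jia–Šverák's Lemma 8, step 3: from the windowed energy bound to the decay at a.e. time

Analysis/FluidPDE proof file (theorems only, no definitions, no named facts) on the way to the
discharge of `Literature.Analysis.FluidPDE.jia_sverak_2013_lemma_8` (H. Jia, V. Šverák 2013,
Lemma 8: near the initial time a local Leray solution stays `L²_loc`-close to the caloric
extension of its datum, uniformly under a bound on `‖u₀‖₃`).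

This file is the real-variable layer of the argument. The windowed energy bound for
`w = u - e^{tΔ}u₀` (`IsLocalLeraySolutionOn.windowed_energy_bound`, file
`JiaSverak2013Lemma8WindowBounds.lean`) has the shape

  `∫ ρ⁻_{δ,τ} Y ≤ ∫ ρ⁺_δ Y + ∫ σ_{δ,τ} Y + K₀ ∫ σ_{δ,τ} P Y + R(δ, τ)`,     `0 < δ`, `4δ ≤ τ`,

for the local energy `Y(t) = ∫ θ |w(t)|² ≥ 0`, the weight `P(t) = ‖e^{tΔ}u₀‖₅⁵ ≥ 0`
(`∫₀^∞ P < ∞`, Giga), the time plateau `σ_{δ,τ} = timePlateau δ τ` and its edge kernels `ρ^±`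
(unit-mass approximate identities concentrating at `t = 0⁺` and at `t = τ⁻`), and a remainder
`R(δ,τ) ≤ a(τ)`, `a ≥ 0` non-decreasing (`JiaSverak2013Lemma8RemainderBound.lean`). Here we show
(`decay_of_window`) that these inequalities imply, for almost every `τ ∈ (0, 1)`,

  `Y(τ) ≤ a(τ) · exp (1 + K₀ ∫₀¹ P)`.

Proof: at a Lebesgue point `τ` of `Y` the left-hand side tends to `Y(τ)` as `δ → 0`
(`tendsto_integral_kernel_mul_of_lebesguePoint`, `SlicedLocalEnergy.lean`), the rising-edge term
tends to `0` because `Y(t) → 0` as `t → 0⁺` (`tendsto_integral_plateauRise_mul_of_tendsto_zero`),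
and the two plateau terms are bounded by `∫₀^τ Y` and `K₀ ∫₀^τ P Y` (`0 ≤ σ ≤ 1`); this gives
`Y(τ) ≤ a(τ) + ∫₀^τ (1 + K₀ P) Y` for a.e. `τ` (`le_of_window_at_lebesguePoint`), and the
integral form of Grönwall's inequality on `[0, S]` (`lintegral_gronwall_le`,
`SerrinEnstrophyGronwall.lean`), applied to `1_G · Y` with `G` the full-measure set of good times,
concludes (Jia–Šverák 2013, proof of Lemma 8: "by Gronwall's inequality … `‖w(t)‖²_{L²(B)} ≤ h(t)`";
Seregin–Šverák 2017, proof of (1.7); Lemarié-Rieusset 2016, proof of Thm. 14.7, p. 518).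

## Mathlib / tree search

Tree: `timePlateau`, `timePlateau_nonneg`, `timePlateau_le_one`, `contDiff_timePlateau`,
`timePlateau_eq_zero_of_notMem` (`KatoLocalLerayPressure.lean`); `plateauRise_nonneg`,
`continuous_plateauRise`, `continuous_plateauFall`, `plateauRise_eq_zero_of_notMem`,
`plateauFall_eq_zero_of_notMem`, `integral_plateauRise`, `integral_plateauFall`
(`PlateauWindowKernels.lean`); `tendsto_integral_kernel_mul_of_lebesguePoint`
(`SlicedLocalEnergy.lean`); `lintegral_gronwall_le` (`SerrinEnstrophyGronwall.lean`);
`Calculus.exists_bound_deriv_smoothTransition` (`Analysis/Calculus/SmoothCutoff.lean`). Mathlib: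
`IsUnifLocDoublingMeasure.ae_tendsto_average_norm_sub`, `ofReal_integral_eq_lintegral_ofReal`,
`le_of_tendsto_of_tendsto'`.

## References

* H. Jia, V. Šverák, *Minimal L³-initial data for potential Navier–Stokes singularities*, SIAM J.
  Math. Anal. 45 (2013) 1448–1459 = arXiv:1201.1592, Lemma 8 (p. 7). [JiaSverak2013]
* G. Seregin, V. Šverák, *On global weak solutions to the Cauchy problem for the Navier–Stokes
  equations with large L₃-initial data*, Nonlinear Anal. 154 (2017) 269–296 = arXiv:1601.03096,
  §1 (1.7). [SereginSverak2017]
* P. G. Lemarié-Rieusset, *The Navier–Stokes problem in the 21st century*, CRC Press 2016,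
  Thm. 14.7, proof pp. 515–518. [LemarieRieusset2016]
-/

noncomputable section

open MeasureTheory TopologicalSpace Set Function Filter Metric
open _root_.Topology
open scoped ENNReal NNReal

namespace Literature.Analysis.FluidPDE

/-! ## The two edge kernels against `Y` -/

section Kernels

/-- **The falling edge at a Lebesgue point**: if `s` is a Lebesgue point of the integrable `U`
(moving-centre form), then `∫ ρ⁻_{δₙ,s} U → U(s)` for `δₙ → 0⁺` (`ρ⁻_{δ,s}` has unit mass, is
supported in `[s - 2δ, s - δ]` and bounded by `‖ST'‖_∞ / δ`). [folklore] -/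
theorem tendsto_integral_plateauFall_mul_of_lebesguePoint {U : ℝ → ℝ} (hU : Integrable U volume)
    {s : ℝ}
    (hs : ∀ (w δ : ℕ → ℝ), Tendsto δ atTop (𝓝[>] 0) →
      (∀ᶠ j in atTop, s ∈ closedBall (w j) (2 * δ j)) →
      Tendsto (fun j => ⨍ y in closedBall (w j) (δ j), ‖U y - U s‖ ∂volume) atTop (𝓝 0))
    {δ : ℕ → ℝ} (hδ : ∀ n, 0 < δ n) (hδ0 : Tendsto δ atTop (𝓝 0)) :
    Tendsto (fun n => ∫ t, ((1 / δ n) * deriv Real.smoothTransition ((s - δ n - t) / δ n)) * U t)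
      atTop (𝓝 (U s)) := by
  obtain ⟨D, -, hD⟩ := Calculus.exists_bound_deriv_smoothTransition
  refine tendsto_integral_kernel_mul_of_lebesguePoint hU hs (C := D) hδ hδ0
    (k := fun n t => (1 / δ n) * deriv Real.smoothTransition ((s - δ n - t) / δ n))
    (fun n => continuous_plateauFall (δ n) s) (fun n t => ?_) (fun n t ht => ?_)
    (fun n => integral_plateauFall (hδ n) s)
  · rw [abs_mul, abs_of_pos (one_div_pos.2 (hδ n))]
    calc 1 / δ n * |deriv Real.smoothTransition ((s - δ n - t) / δ n)| ≤ 1 / δ n * D :=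
          mul_le_mul_of_nonneg_left (hD _) (one_div_pos.2 (hδ n)).le
      _ = D / δ n := by ring
  · have hmem : t ∈ Icc (s - 2 * δ n) (s - δ n) := by
      by_contra h
      exact ht (plateauFall_eq_zero_of_notMem (hδ n) h)
    exact ⟨hmem.1, hmem.2.trans (by linarith [hδ n])⟩

/-- **The rising edge against a function vanishing at `0⁺`**: if `Y ≥ 0` is integrable on `(0,1)`
and `Y(t) → 0` as `t → 0⁺`, then `∫ ρ⁺_{δₙ} Y → 0` for `δₙ → 0⁺` (`ρ⁺_δ ≥ 0` has unit mass and is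
supported in `[δ, 2δ]`). [folklore] -/
theorem tendsto_integral_plateauRise_mul_of_tendsto_zero {Y : ℝ → ℝ} (hY0 : ∀ t, 0 ≤ Y t)
    (hYlim : Tendsto Y (𝓝[>] 0) (𝓝 0)) (hYI : IntegrableOn Y (Ioo (0 : ℝ) 1) volume)
    {δ : ℕ → ℝ} (hδ : ∀ n, 0 < δ n) (hδ1 : ∀ n, 2 * δ n < 1) (hδ0 : Tendsto δ atTop (𝓝 0)) :
    Tendsto (fun n => ∫ t, ((1 / δ n) * deriv Real.smoothTransition ((t - δ n) / δ n)) * Y t)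
      atTop (𝓝 0) := by
  obtain ⟨D, -, hD⟩ := Calculus.exists_bound_deriv_smoothTransition
  set U : ℝ → ℝ := (Ioo (0 : ℝ) 1).indicator Y with hU
  have hIU : Integrable U volume := (integrable_indicator_iff measurableSet_Ioo).2 hYI
  have hk0 : ∀ n t, t ∉ Icc (δ n) (2 * δ n) →
      (1 / δ n) * deriv Real.smoothTransition ((t - δ n) / δ n) = 0 := fun n t ht =>
    plateauRise_eq_zero_of_notMem (hδ n) ht
  have hkU : ∀ n t, ((1 / δ n) * deriv Real.smoothTransition ((t - δ n) / δ n)) * Y t =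
      ((1 / δ n) * deriv Real.smoothTransition ((t - δ n) / δ n)) * U t := by
    intro n t
    by_cases ht : t ∈ Icc (δ n) (2 * δ n)
    · have htI : t ∈ Ioo (0 : ℝ) 1 := ⟨(hδ n).trans_le ht.1, ht.2.trans_lt (hδ1 n)⟩
      rw [hU, indicator_of_mem htI]
    · rw [hk0 n t ht, zero_mul, zero_mul]
  have hint : ∀ n, Integrable
      (fun t => ((1 / δ n) * deriv Real.smoothTransition ((t - δ n) / δ n)) * Y t) volume := by
    intro n
    have h1 : Integrable
        (fun t => ((1 / δ n) * deriv Real.smoothTransition ((t - δ n) / δ n)) * U t) volume :=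
      hIU.bdd_mul (continuous_plateauRise (δ n)).aestronglyMeasurable
        (Eventually.of_forall fun t => by
          rw [Real.norm_eq_abs, abs_mul, abs_of_pos (one_div_pos.2 (hδ n))]
          exact mul_le_mul_of_nonneg_left (hD _) (one_div_pos.2 (hδ n)).le)
    exact h1.congr (Eventually.of_forall fun t => (hkU n t).symm)
  rw [Metric.tendsto_atTop]
  intro ε hε
  have hev : ∀ᶠ t in 𝓝[>] (0 : ℝ), Y t < ε / 2 := hYlim (Iio_mem_nhds (half_pos hε))
  rw [eventually_nhdsWithin_iff, Metric.eventually_nhds_iff] at hev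
  obtain ⟨d, hd, hdY⟩ := hev
  obtain ⟨N, hN⟩ := eventually_atTop.1 ((tendsto_order.1 hδ0).2 (d / 2) (half_pos hd))
  refine ⟨N, fun n hn => ?_⟩
  have hδd : 2 * δ n < d := by linarith [hN n hn]
  rw [Real.dist_eq, sub_zero]
  have hrise_int : Integrable (fun t => (1 / δ n) * deriv Real.smoothTransition ((t - δ n) / δ n))
      volume :=
    (continuous_plateauRise (δ n)).integrable_of_hasCompactSupport
      (HasCompactSupport.intro isCompact_Icc (hk0 n))
  have hup : ∫ t, ((1 / δ n) * deriv Real.smoothTransition ((t - δ n) / δ n)) * Y t ≤ ε / 2 := by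
    calc ∫ t, ((1 / δ n) * deriv Real.smoothTransition ((t - δ n) / δ n)) * Y t
        ≤ ∫ t, ((1 / δ n) * deriv Real.smoothTransition ((t - δ n) / δ n)) * (ε / 2) := by
          refine integral_mono (hint n) (hrise_int.mul_const _) fun t => ?_
          dsimp only
          by_cases ht : t ∈ Icc (δ n) (2 * δ n)
          · refine mul_le_mul_of_nonneg_left (le_of_lt (hdY ?_ ?_)) (plateauRise_nonneg (hδ n) t)
            · rw [dist_zero_right, Real.norm_eq_abs, abs_of_pos ((hδ n).trans_le ht.1)]
              linarith [ht.2]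
            · exact (hδ n).trans_le ht.1
          · rw [hk0 n t ht, zero_mul, zero_mul]
      _ = ε / 2 := by rw [integral_mul_const, integral_plateauRise (hδ n), one_mul]
  have hlow : 0 ≤ ∫ t, ((1 / δ n) * deriv Real.smoothTransition ((t - δ n) / δ n)) * Y t :=
    integral_nonneg fun t => mul_nonneg (plateauRise_nonneg (hδ n) t) (hY0 t)
  rw [abs_of_nonneg hlow]
  linarith

end Kernels

/-! ## Passing to the limit `δ → 0` at a Lebesgue point -/

section Layer

/-- Finiteness of `∫₀^τ P Y` for `Y` a.e. bounded and `P` integrable. [folklore] -/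
theorem lintegral_ofReal_mul_lt_top_of_ae_le {Y P : ℝ → ℝ} {Ybar τ : ℝ}
    (hYb : ∀ᵐ t ∂(volume.restrict (Ioo (0 : ℝ) 1)), Y t ≤ Ybar) (hP0 : ∀ t, 0 ≤ P t)
    (hPfin : ∫⁻ t in Ioo (0 : ℝ) 1, ENNReal.ofReal (P t) < ∞) (hτ1 : τ ≤ 1) :
    ∫⁻ t in Ioo 0 τ, ENNReal.ofReal (P t * Y t) < ∞ := by
  have hsub : Ioo (0 : ℝ) τ ⊆ Ioo 0 1 := Ioo_subset_Ioo le_rfl hτ1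
  have hb : ∀ᵐ t ∂(volume.restrict (Ioo 0 τ)),
      ENNReal.ofReal (P t * Y t) ≤ ENNReal.ofReal (P t) * ENNReal.ofReal Ybar := by
    filter_upwards [ae_restrict_of_ae_restrict_of_subset hsub hYb] with t ht
    rw [ENNReal.ofReal_mul (hP0 t)]
    exact mul_le_mul' le_rfl (ENNReal.ofReal_le_ofReal ht)
  calc ∫⁻ t in Ioo 0 τ, ENNReal.ofReal (P t * Y t)
      ≤ ∫⁻ t in Ioo 0 τ, ENNReal.ofReal (P t) * ENNReal.ofReal Ybar := lintegral_mono_ae hb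
    _ = (∫⁻ t in Ioo 0 τ, ENNReal.ofReal (P t)) * ENNReal.ofReal Ybar :=
        lintegral_mul_const' _ _ ENNReal.ofReal_ne_top
    _ < ∞ := ENNReal.mul_lt_top ((lintegral_mono_set hsub).trans_lt hPfin) ENNReal.ofReal_lt_top

/-- **The windowed bound at a Lebesgue point.** Let `Y ≥ 0` be integrable on `(0,1)`, a.e.
bounded, with `Y(t) → 0` as `t → 0⁺`, let `P ≥ 0` with `∫₀¹ P < ∞`, `K₀ ≥ 0`, and assume the
windowed inequalities `∫ ρ⁻_{δ,τ} Y ≤ ∫ ρ⁺_δ Y + ∫ σ_{δ,τ} Y + K₀ ∫ σ_{δ,τ} P Y + r` for all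
`0 < δ ≤ τ/4`. If `τ ∈ (0,1)` is a Lebesgue point of `1_{(0,1)} Y`, then
`Y(τ) ≤ r + ∫₀^τ Y + K₀ ∫₀^τ P Y` (let `δ → 0`: the falling edge is an approximate identity at `τ⁻`,
the rising edge one at `0⁺`, and `0 ≤ σ ≤ 1_{(0,τ)}`). (Jia–Šverák 2013, proof of Lemma 8;
Lemarié-Rieusset 2016, proof of Thm. 14.7, p. 518.)
[cite: JiaSverak2013, Lemma 8, proof (arXiv:1201.1592 p. 7)] -/
theorem le_of_window_at_lebesguePoint {Y P : ℝ → ℝ} {Ybar K₀ r τ : ℝ}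
    (hY0 : ∀ t, 0 ≤ Y t) (hYI : IntegrableOn Y (Ioo (0 : ℝ) 1) volume)
    (hYb : ∀ᵐ t ∂(volume.restrict (Ioo (0 : ℝ) 1)), Y t ≤ Ybar)
    (hYlim : Tendsto Y (𝓝[>] 0) (𝓝 0))
    (hP0 : ∀ t, 0 ≤ P t) (hPfin : ∫⁻ t in Ioo (0 : ℝ) 1, ENNReal.ofReal (P t) < ∞) (hK₀ : 0 ≤ K₀)
    (hτ : τ ∈ Ioo (0 : ℝ) 1)
    (hLeb : ∀ (w δ : ℕ → ℝ), Tendsto δ atTop (𝓝[>] 0) →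
      (∀ᶠ j in atTop, τ ∈ closedBall (w j) (2 * δ j)) →
      Tendsto (fun j => ⨍ y in closedBall (w j) (δ j),
        ‖(Ioo (0 : ℝ) 1).indicator Y y - (Ioo (0 : ℝ) 1).indicator Y τ‖ ∂volume) atTop (𝓝 0))
    (hwin : ∀ δ : ℝ, 0 < δ → 4 * δ ≤ τ →
      ∫ t, ((1 / δ) * deriv Real.smoothTransition ((τ - δ - t) / δ)) * Y t ≤
        (∫ t, ((1 / δ) * deriv Real.smoothTransition ((t - δ) / δ)) * Y t) +
        (∫ t, timePlateau δ τ t * Y t) +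
        K₀ * (∫⁻ t, ENNReal.ofReal (timePlateau δ τ t * (P t * Y t))).toReal + r) :
    Y τ ≤ r + (∫ t in Ioo 0 τ, Y t) + K₀ * (∫⁻ t in Ioo 0 τ, ENNReal.ofReal (P t * Y t)).toReal := by
  obtain ⟨hτ0, hτ1⟩ := hτ
  set U : ℝ → ℝ := (Ioo (0 : ℝ) 1).indicator Y with hU
  have hIU : Integrable U volume := (integrable_indicator_iff measurableSet_Ioo).2 hYI
  -- ### the sequence of widths `δₙ = τ / (4(n+1))`
  set δ : ℕ → ℝ := fun n => τ / (4 * ((n : ℝ) + 1)) with hδdef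
  have hδpos : ∀ n, 0 < δ n := fun n => by simp only [hδdef]; positivity
  have hδτ : ∀ n, 4 * δ n ≤ τ := fun n => by
    simp only [hδdef]
    rw [mul_div_assoc', div_le_iff₀ (by positivity : (0 : ℝ) < 4 * ((n : ℝ) + 1))]
    have := mul_nonneg hτ0.le (n.cast_nonneg (α := ℝ))
    nlinarith
  have hδ0 : Tendsto δ atTop (𝓝 0) := by
    have h := (tendsto_one_div_add_atTop_nhds_zero_nat).const_mul (τ / 4)
    rw [mul_zero] at h
    refine h.congr fun n => ?_
    simp only [hδdef]
    field_simp
  have hδ1 : ∀ n, 2 * δ n < 1 := fun n => by linarith [hδτ n, hδpos n]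
  -- ### the falling edge: `∫ ρ⁻ₙ Y = ∫ ρ⁻ₙ U → U τ = Y τ`
  have hfallU : ∀ n t, ((1 / δ n) * deriv Real.smoothTransition ((τ - δ n - t) / δ n)) * Y t =
      ((1 / δ n) * deriv Real.smoothTransition ((τ - δ n - t) / δ n)) * U t := by
    intro n t
    by_cases ht : t ∈ Icc (τ - 2 * δ n) (τ - δ n)
    · have htI : t ∈ Ioo (0 : ℝ) 1 :=
        ⟨by linarith [ht.1, hδτ n, hδpos n], by linarith [ht.2, hδpos n]⟩
      rw [hU, indicator_of_mem htI]
    · rw [plateauFall_eq_zero_of_notMem (hδpos n) ht, zero_mul, zero_mul]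
  have hUτ : U τ = Y τ := by
    rw [hU, indicator_of_mem (show τ ∈ Ioo (0 : ℝ) 1 from ⟨hτ0, hτ1⟩)]
  have hlimF : Tendsto
      (fun n => ∫ t, ((1 / δ n) * deriv Real.smoothTransition ((τ - δ n - t) / δ n)) * Y t)
      atTop (𝓝 (Y τ)) := by
    have h := tendsto_integral_plateauFall_mul_of_lebesguePoint hIU hLeb hδpos hδ0
    rw [hUτ] at h
    exact h.congr fun n => integral_congr_ae (Eventually.of_forall fun t => (hfallU n t).symm)
  -- ### the rising edge: `∫ ρ⁺ₙ Y → 0`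
  have hlimR := tendsto_integral_plateauRise_mul_of_tendsto_zero hY0 hYlim hYI hδpos hδ1 hδ0
  -- ### the plateau terms: `∫ σₙ Y ≤ ∫₀^τ Y`, `∫ σₙ P Y ≤ ∫₀^τ P Y`
  have hsub : Ioo (0 : ℝ) τ ⊆ Ioo 0 1 := Ioo_subset_Ioo le_rfl hτ1.le
  have hYIτ : IntegrableOn Y (Ioo 0 τ) volume := hYI.mono_set hsub
  have hσ0 : ∀ n t, t ∉ Ioo 0 τ → timePlateau (δ n) τ t = 0 := fun n t ht =>
    timePlateau_eq_zero_of_notMem (hδpos n) fun h => ht ⟨(hδpos n).trans h.1, by linarith [h.2, hδpos n]⟩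
  have hS : ∀ n, ∫ t, timePlateau (δ n) τ t * Y t ≤ ∫ t in Ioo 0 τ, Y t := by
    intro n
    rw [← integral_indicator measurableSet_Ioo]
    have hσint : Integrable (fun t => timePlateau (δ n) τ t * Y t) volume := by
      have h1 : Integrable (fun t => timePlateau (δ n) τ t * (Ioo 0 τ).indicator Y t) volume :=
        ((integrable_indicator_iff measurableSet_Ioo).2 hYIτ).bdd_mul
          (contDiff_timePlateau (δ n) τ (n := 0)).continuous.aestronglyMeasurable
          (Eventually.of_forall fun t => by
            rw [Real.norm_eq_abs, abs_of_nonneg (timePlateau_nonneg _ _ _)]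
            exact timePlateau_le_one _ _ _)
      refine h1.congr (Eventually.of_forall fun t => ?_)
      dsimp only
      by_cases ht : t ∈ Ioo 0 τ
      · rw [indicator_of_mem ht]
      · rw [hσ0 n t ht, zero_mul, zero_mul]
    refine integral_mono hσint ((integrable_indicator_iff measurableSet_Ioo).2 hYIτ) fun t => ?_
    dsimp only
    by_cases ht : t ∈ Ioo 0 τ
    · rw [indicator_of_mem ht]
      exact mul_le_of_le_one_left (hY0 t) (timePlateau_le_one _ _ _)
    · rw [hσ0 n t ht, zero_mul, indicator_of_notMem ht]
  have hLYfin : ∫⁻ t in Ioo 0 τ, ENNReal.ofReal (P t * Y t) < ∞ :=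
    lintegral_ofReal_mul_lt_top_of_ae_le hYb hP0 hPfin hτ1.le
  have hL : ∀ n, (∫⁻ t, ENNReal.ofReal (timePlateau (δ n) τ t * (P t * Y t))).toReal ≤
      (∫⁻ t in Ioo 0 τ, ENNReal.ofReal (P t * Y t)).toReal := by
    intro n
    refine ENNReal.toReal_mono hLYfin.ne ?_
    rw [← lintegral_indicator measurableSet_Ioo]
    refine lintegral_mono fun t => ?_
    by_cases ht : t ∈ Ioo 0 τ
    · rw [indicator_of_mem ht]
      exact ENNReal.ofReal_le_ofReal
        (mul_le_of_le_one_left (mul_nonneg (hP0 t) (hY0 t)) (timePlateau_le_one _ _ _))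
    · rw [indicator_of_notMem ht, hσ0 n t ht, zero_mul, ENNReal.ofReal_zero]
  -- ### pass to the limit
  have hstep : ∀ n, ∫ t, ((1 / δ n) * deriv Real.smoothTransition ((τ - δ n - t) / δ n)) * Y t ≤
      (∫ t, ((1 / δ n) * deriv Real.smoothTransition ((t - δ n) / δ n)) * Y t) +
      ((∫ t in Ioo 0 τ, Y t) + K₀ * (∫⁻ t in Ioo 0 τ, ENNReal.ofReal (P t * Y t)).toReal + r) := by
    intro n
    have h := hwin (δ n) (hδpos n) (hδτ n)
    have h2 := hS n
    have h3 := mul_le_mul_of_nonneg_left (hL n) hK₀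
    linarith
  have hlim2 := hlimR.add_const
    ((∫ t in Ioo 0 τ, Y t) + K₀ * (∫⁻ t in Ioo 0 τ, ENNReal.ofReal (P t * Y t)).toReal + r)
  have := le_of_tendsto_of_tendsto' hlimF hlim2 hstep
  linarith

/-- **From the windowed energy bound to the decay at almost every time** (Jia–Šverák 2013,
proof of Lemma 8, Gronwall step; Seregin–Šverák 2017, proof of (1.7); Lemarié-Rieusset 2016,
proof of Thm. 14.7, p. 518). Let `Y ≥ 0` be measurable and a.e. bounded on `(0,1)` with
`Y(t) → 0` as `t → 0⁺`, `P ≥ 0` with `∫₀¹ P < ∞`, `K₀ ≥ 0`, `a ≥ 0` non-decreasing, and assume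
the windowed inequalities
`∫ ρ⁻_{δ,τ} Y ≤ ∫ ρ⁺_δ Y + ∫ σ_{δ,τ} Y + K₀ ∫ σ_{δ,τ} P Y + a(τ)` for `0 < δ`, `4δ ≤ τ < 1`
(`σ_{δ,τ} = timePlateau δ τ`, `ρ^±` its edge kernels). Then for a.e. `τ ∈ (0,1)`,
`Y(τ) ≤ a(τ) exp (1 + K₀ ∫₀¹ P)`.
[cite: JiaSverak2013, Lemma 8, proof (arXiv:1201.1592 p. 7)] -/
theorem decay_of_window {Y P a : ℝ → ℝ} {Ybar K₀ : ℝ}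
    (hY0 : ∀ t, 0 ≤ Y t) (hYm : AEStronglyMeasurable Y (volume.restrict (Ioo (0 : ℝ) 1)))
    (hYb : ∀ᵐ t ∂(volume.restrict (Ioo (0 : ℝ) 1)), Y t ≤ Ybar)
    (hYlim : Tendsto Y (𝓝[>] 0) (𝓝 0))
    (hP0 : ∀ t, 0 ≤ P t) (hPfin : ∫⁻ t in Ioo (0 : ℝ) 1, ENNReal.ofReal (P t) < ∞)
    (hK₀ : 0 ≤ K₀) (ha0 : ∀ t, 0 ≤ a t) (hmono : Monotone a)
    (hwin : ∀ δ τ : ℝ, 0 < δ → 4 * δ ≤ τ → τ < 1 →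
      ∫ t, ((1 / δ) * deriv Real.smoothTransition ((τ - δ - t) / δ)) * Y t ≤
        (∫ t, ((1 / δ) * deriv Real.smoothTransition ((t - δ) / δ)) * Y t) +
        (∫ t, timePlateau δ τ t * Y t) +
        K₀ * (∫⁻ t, ENNReal.ofReal (timePlateau δ τ t * (P t * Y t))).toReal + a τ) :
    ∀ᵐ τ ∂(volume.restrict (Ioo (0 : ℝ) 1)),
      Y τ ≤ a τ * Real.exp (1 + K₀ * (∫⁻ t in Ioo (0 : ℝ) 1, ENNReal.ofReal (P t)).toReal) := by
  -- ### integrability of `Y` on `(0,1)` and Lebesgue points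
  have hYI : IntegrableOn Y (Ioo (0 : ℝ) 1) volume := by
    refine Integrable.mono' (integrableOn_const (C := Ybar)
      (by rw [Real.volume_Ioo]; exact ENNReal.ofReal_ne_top)) hYm ?_
    filter_upwards [hYb] with t ht
    rw [Real.norm_eq_abs, abs_of_nonneg (hY0 t)]
    exact ht
  have hIU : Integrable ((Ioo (0 : ℝ) 1).indicator Y) volume :=
    (integrable_indicator_iff measurableSet_Ioo).2 hYI
  have hLeb := IsUnifLocDoublingMeasure.ae_tendsto_average_norm_sub (μ := (volume : Measure ℝ))
    hIU.locallyIntegrable 2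
  -- ### (A) the integral inequality at a.e. `τ`
  have hA : ∀ᵐ τ ∂(volume.restrict (Ioo (0 : ℝ) 1)), Y τ ≤ a τ + (∫ t in Ioo 0 τ, Y t) +
      K₀ * (∫⁻ t in Ioo 0 τ, ENNReal.ofReal (P t * Y t)).toReal := by
    filter_upwards [ae_restrict_of_ae (s := Ioo (0 : ℝ) 1) hLeb, ae_restrict_mem measurableSet_Ioo]
      with τ hτL hτI
    exact le_of_window_at_lebesguePoint hY0 hYI hYb hYlim hP0 hPfin hK₀ hτI
      (fun w δ hδ hm => hτL w δ hδ hm) (fun δ hδ hδτ => hwin δ τ hδ hδτ hτI.2)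
  -- ### (B) Gronwall on the good set
  set G : Set ℝ := {t | t ∈ Ioo (0 : ℝ) 1 ∧ Y t ≤ Ybar ∧ Y t ≤ a t + (∫ s in Ioo 0 t, Y s) +
      K₀ * (∫⁻ s in Ioo 0 t, ENNReal.ofReal (P s * Y s)).toReal} with hG
  have hGae : ∀ᵐ t ∂(volume.restrict (Ioo (0 : ℝ) 1)), t ∈ G := by
    filter_upwards [ae_restrict_mem measurableSet_Ioo, hYb, hA] with t h1 h2 h3
    exact ⟨h1, h2, h3⟩
  set LI : ℝ≥0∞ := ∫⁻ t in Ioo (0 : ℝ) 1, ENNReal.ofReal (P t) with hLI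
  have hLIfin : LI ≠ ∞ := hPfin.ne
  set α : ℝ → ℝ≥0∞ := fun t => ENNReal.ofReal (1 + K₀ * P t) with hα
  set φ : ℝ → ℝ≥0∞ := G.indicator fun t => ENNReal.ofReal (Y t) with hφ
  have hαle : ∀ S, S ≤ 1 → ∫⁻ t in Ioo 0 S, α t ≤ ENNReal.ofReal 1 + ENNReal.ofReal K₀ * LI := by
    intro S hS
    have e : ∀ t, α t = ENNReal.ofReal 1 + ENNReal.ofReal K₀ * ENNReal.ofReal (P t) := fun t => by
      simp only [hα]
      rw [ENNReal.ofReal_add zero_le_one (mul_nonneg hK₀ (hP0 t)), ENNReal.ofReal_mul hK₀]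
    simp_rw [e]
    rw [lintegral_add_left measurable_const, lintegral_const_mul' _ _ ENNReal.ofReal_ne_top,
      setLIntegral_const]
    have hv : ENNReal.ofReal 1 * volume (Ioo (0 : ℝ) S) ≤ ENNReal.ofReal 1 := by
      rw [Real.volume_Ioo, sub_zero]
      calc ENNReal.ofReal 1 * ENNReal.ofReal S ≤ ENNReal.ofReal 1 * ENNReal.ofReal 1 :=
            mul_le_mul' le_rfl (ENNReal.ofReal_le_ofReal hS)
        _ = ENNReal.ofReal 1 := by simp
    have hm : ∫⁻ t in Ioo 0 S, ENNReal.ofReal (P t) ≤ LI := lintegral_mono_set (Ioo_subset_Ioo le_rfl hS)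
    exact add_le_add hv (mul_le_mul' le_rfl hm)
  have hTop : ENNReal.ofReal 1 + ENNReal.ofReal K₀ * LI ≠ ∞ :=
    ENNReal.add_ne_top.2 ⟨ENNReal.ofReal_ne_top, ENNReal.mul_ne_top ENNReal.ofReal_ne_top hLIfin⟩
  have hmain : ∀ S ∈ G, Y S ≤ a S * Real.exp (1 + K₀ * LI.toReal) := by
    intro S hS
    have hSG := hS
    obtain ⟨hSI, -, -⟩ := hS
    have hS1 : S ≤ 1 := hSI.2.le
    have hφM : ∀ t ∈ Icc 0 S, φ t ≤ ENNReal.ofReal Ybar := by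
      intro t _
      simp only [hφ]
      by_cases ht : t ∈ G
      · rw [indicator_of_mem ht]
        exact ENNReal.ofReal_le_ofReal ht.2.1
      · rw [indicator_of_notMem ht]
        exact zero_le
    have hαfin : ∫⁻ t in Ioo 0 S, α t ≠ ⊤ := ne_top_of_le_ne_top hTop (hαle S hS1)
    have hφineq : ∀ t ∈ Icc 0 S, φ t ≤ ENNReal.ofReal (a S) + ∫⁻ s in Ioo 0 t, α s * φ s := by
      intro t ht
      by_cases htG : t ∈ G
      swap
      · simp only [hφ]
        rw [indicator_of_notMem htG]
        exact zero_le
      have hmem := htG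
      obtain ⟨htI, -, htineq⟩ := htG
      have ht1 : t ≤ 1 := htI.2.le
      have hsub : Ioo (0 : ℝ) t ⊆ Ioo 0 1 := Ioo_subset_Ioo le_rfl ht1
      simp only [hφ]
      rw [indicator_of_mem hmem]
      have hYIt : IntegrableOn Y (Ioo 0 t) volume := hYI.mono_set hsub
      have hSY0 : 0 ≤ ∫ s in Ioo 0 t, Y s := setIntegral_nonneg measurableSet_Ioo fun s _ => hY0 s
      have hLYfin : ∫⁻ s in Ioo 0 t, ENNReal.ofReal (P s * Y s) < ∞ :=
        lintegral_ofReal_mul_lt_top_of_ae_le hYb hP0 hPfin ht1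
      have e1 : ENNReal.ofReal (∫ s in Ioo 0 t, Y s) = ∫⁻ s in Ioo 0 t, ENNReal.ofReal (Y s) :=
        ofReal_integral_eq_lintegral_ofReal hYIt (ae_of_all _ fun s => hY0 s)
      have e2 : ENNReal.ofReal (K₀ * (∫⁻ s in Ioo 0 t, ENNReal.ofReal (P s * Y s)).toReal) =
          ENNReal.ofReal K₀ * ∫⁻ s in Ioo 0 t, ENNReal.ofReal (P s * Y s) := by
        rw [ENNReal.ofReal_mul hK₀, ENNReal.ofReal_toReal hLYfin.ne]
      have hmeasY : AEMeasurable (fun s => ENNReal.ofReal (Y s)) (volume.restrict (Ioo 0 t)) :=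
        (hYm.mono_measure (Measure.restrict_mono hsub le_rfl)).aemeasurable.ennreal_ofReal
      have e3 : (∫⁻ s in Ioo 0 t, ENNReal.ofReal (Y s)) +
          ENNReal.ofReal K₀ * ∫⁻ s in Ioo 0 t, ENNReal.ofReal (P s * Y s) =
          ∫⁻ s in Ioo 0 t, α s * ENNReal.ofReal (Y s) := by
        rw [← lintegral_const_mul' _ _ ENNReal.ofReal_ne_top, ← lintegral_add_left' hmeasY]
        refine lintegral_congr fun s => ?_
        simp only [hα]
        rw [ENNReal.ofReal_add zero_le_one (mul_nonneg hK₀ (hP0 s)), ENNReal.ofReal_one, add_mul,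
          one_mul, ENNReal.ofReal_mul hK₀, ENNReal.ofReal_mul (hP0 s), mul_assoc]
      have e4 : ∫⁻ s in Ioo 0 t, α s * ENNReal.ofReal (Y s) = ∫⁻ s in Ioo 0 t, α s * φ s := by
        refine lintegral_congr_ae ?_
        filter_upwards [ae_restrict_of_ae_restrict_of_subset hsub hGae] with s hs
        simp only [hφ]
        rw [indicator_of_mem hs]
      calc ENNReal.ofReal (Y t)
          ≤ ENNReal.ofReal (a t + (∫ s in Ioo 0 t, Y s) +
              K₀ * (∫⁻ s in Ioo 0 t, ENNReal.ofReal (P s * Y s)).toReal) :=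
            ENNReal.ofReal_le_ofReal htineq
        _ = ENNReal.ofReal (a t) + (∫⁻ s in Ioo 0 t, ENNReal.ofReal (Y s)) +
              ENNReal.ofReal K₀ * ∫⁻ s in Ioo 0 t, ENNReal.ofReal (P s * Y s) := by
            rw [ENNReal.ofReal_add (add_nonneg (ha0 t) hSY0) (by positivity),
              ENNReal.ofReal_add (ha0 t) hSY0, e1, e2]
        _ ≤ ENNReal.ofReal (a S) + ∫⁻ s in Ioo 0 t, α s * φ s := by
            rw [add_assoc, e3, e4]
            exact add_le_add (ENNReal.ofReal_le_ofReal (hmono ht.2)) le_rfl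
    have hGr := lintegral_gronwall_le (S := S) ENNReal.ofReal_ne_top ENNReal.ofReal_ne_top hφM hαfin
      hφineq S ⟨hSI.1.le, le_rfl⟩
    have hφS : φ S = ENNReal.ofReal (Y S) := by
      simp only [hφ]
      rw [indicator_of_mem hSG]
    rw [hφS] at hGr
    have hexp : (∫⁻ s in Ioo 0 S, α s).toReal ≤ 1 + K₀ * LI.toReal := by
      have h := ENNReal.toReal_mono hTop (hαle S hS1)
      rwa [ENNReal.toReal_add ENNReal.ofReal_ne_top (ENNReal.mul_ne_top ENNReal.ofReal_ne_top hLIfin),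
        ENNReal.toReal_mul, ENNReal.toReal_ofReal zero_le_one, ENNReal.toReal_ofReal hK₀] at h
    have hfin : Y S ≤ a S * Real.exp (∫⁻ s in Ioo 0 S, α s).toReal := by
      rw [← ENNReal.ofReal_mul (ha0 S)] at hGr
      exact (ENNReal.ofReal_le_ofReal_iff (mul_nonneg (ha0 S) (Real.exp_nonneg _))).1 hGr
    exact hfin.trans (mul_le_mul_of_nonneg_left (Real.exp_le_exp.2 hexp) (ha0 S))
  filter_upwards [hGae] with S hS using hmain S hS

end Layer

end Literature.Analysis.FluidPDE
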